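import Summits.HodgeConjecture.FermatCycles.ConditionQFourfoldSearch
import Summits.HodgeConjecture.FermatCycles.ConditionQFourfoldNinetySixTable
import Summits.HodgeConjecture.FermatCycles.ConditionQFourfoldNinetySixA
import Summits.HodgeConjecture.FermatCycles.ConditionQFourfoldNinetySixB
import Summits.HodgeConjecture.FermatCycles.ConditionQFourfoldNinetySixC
import Summits.HodgeConjecture.FermatCycles.ConditionQFourfoldNinetySixD
import Summits.HodgeConjecture.FermatCycles.ConditionQFourfoldNinetySixE
import Summits.HodgeConjecture.FermatCycles.ConditionQFourfoldNinetySixF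
import Summits.HodgeConjecture.FermatCycles.ConditionQFourfoldNinetySixG
import Summits.HodgeConjecture.FermatCycles.ConditionQFourfoldNinetySixH
import Summits.HodgeConjecture.FermatCycles.ConditionQFourfoldNinetySixI
import HarnessLib

/-!
# Shioda's stable-generation condition `(Q⁴ₘ)` at `m = 96` and the failure of `(P⁴ₘ)` — kernel certificate (part J of 10)

HONEST FRAMING: explicit algebraic cycles for specific Hodge classes on Fermat/Delsarte varieties;
residual open instances listed; no claim on general Hodge.

Topic path `Summits/HodgeConjecture/FermatCycles/` of cell `pub-hfermat` (new work, not literature: a computer determination of the cell —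
`pub-hfermat-enum/P4-TABLE.md` §(Q⁴ₘ), two implementations — certified by the Lean kernel). Framework: `ConditionQFourfold.lean`
(certificate Booleans, searches `checkQU`/`checkQN`) and `ConditionQFourfoldSearch.lean` (`conditionQ_four_of_normalized`).

THE STATEMENT. Shioda, Math. Ann. 245 (1979) §4 p. 183: `(Qⁿₘ)` — every element of `Mₘ(y)`, `3 ≤ y ≤ n/2 + 1`, is `ξ₁ − ξ₂` with
`ξ₁, ξ₂ ∈ M'ₘ = ⟨Mₘ(1), Mₘ(2), Mₘ(3)^sd⟩` (pairs, Hodge classes of the Fermat surface, semi-decomposable sextuples); by his Claim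
(p. 183, Lemmas 2–3) `(Qⁿₘ)` may replace `(Pⁿₘ)` in Theorem III (`⇒` the Hodge conjecture for `Xⁿₘ`); p. 184: "we do not know any
value of `m` which satisfies `(Qₘ)` but not `(Pₘ)`". Tree: `Literature.AlgebraicGeometry.Shioda1979.ConditionQ m n`, `MPrime`,
`forall_of_conditionQ` (the Claim's arithmetic spine), `ConditionP` (Math. Ann. form of `(P)`), `FermatCharacter.ShiodaConditionUpTo`
(Proc. Japan Acad. form, with the semi-decomposable alternative).

WHAT IS PROVED HERE (level `m = 96`, part J).
* part J of 10: the kernel searches `checkQN 96 T 32 64` (40799 tuples);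
* **`conditionQ_ninetySix_four : Shioda1979.ConditionQ 96 4`** — `(Q⁴ₘ)` holds at `m = 96`: every Hodge sextuple over `ℤ/96` (every Hodge character of the
  Fermat fourfold `X⁴ₘ`, `m = 96`, up to permutation) is `ξ₁ − ξ₂`, `ξᵢ ∈ M'ₘ`;
* `forall_of_closed_cancellative_ninetySix`: by Shioda's Claim (`forall_of_conditionQ`), every Shioda-closed, Lemma-3-cancellative family of
  multisets over `ℤ/96` contains every non-empty Hodge multiset of cardinality `≤ 6`;
* the NEGATIVE side on the sextuple `s = (1, 6, 15, 79, 93, 94)`: Hodge (`isHodgeMultiset_fail_ninetySix`), no proper non-empty sub-multiset with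
  zero sum (`sum_ne_zero_of_mem_powerset_fail_ninetySix`: hence not decomposable, not semi-decomposable), not quasi-decomposable (`fail_ninetySix_key`,
  `96 · 2⁸` kernel cases) ⇒ **`not_shiodaConditionUpTo_ninetySix_four : ¬ ShiodaConditionUpTo 96 4`** (the Proc. Japan Acad. form of `(P⁴ₘ)`
  fails), `not_conditionP_ninetySix_four : ¬ Shioda1979.ConditionP 96 4` (the Math. Ann. form fails), and the conjunction
  `conditionQ_not_conditionP_ninetySix : ConditionQ 96 4 ∧ ¬ ConditionP 96 4` — at `m = 96`, for fourfolds, Shioda's weakening `(Q)` of `(P)` is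
  NECESSARY as well as sufficient.

NUMBERS (this seat's search `code/lit/q4/q4norm.py` = implementation 2; implementation 1 = ENUM `code/enum/q4table.py`,
`data/shioda_Q4_m3-100.json`): case U visits 343692 sorted tuples and case N 921695; 13393 of them are Hodge sextuples; all but 192 carry a
`(P)`-witness (case N pair 10208, case N quasi 1194, case N semi 218, case U pair 1497, case U quasi 81, case U semi 3); the other 192 — `(1, 6, 15, 79, 93, 94)` (case U); `(1, 14, 49, 66, 68, 90)` (case U); `(1, 15, 34, 66, 79, 93)` (case U); `(1, 15, 51, 62, 65, 94)` (case U); `(1, 15, 51, 65, 66, 90)` (case U); `(1, 17, 49, 65, 66, 90)` (case U); `(1, 25, 49, 52, 73, 88)` (case U); `(1, 25, 49, 64, 73, 76)` (case U); `(1, 25, 49, 68, 72, 73)` (case U); `(1, 30, 33, 51, 79, 94)` (case U); `(1, 33, 34, 49, 81, 90)` (case U); `(1, 33, 34, 51, 79, 90)` (case U); `(1, 34, 36, 49, 78, 90)` (case U); `(1, 34, 45, 49, 66, 93)` (case U); `(1, 34, 49, 54, 66, 84)` (case U); `(1, 34, 49, 54, 72, 78)` (case U); `(2, 12, 14, 78,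 90, 92)` (case N); `(2, 14, 27, 75, 78, 92)` (case N); `(2, 14, 33, 68, 81, 90)` (case N); `(2, 14, 36, 68, 78, 90)` (case N); `(2, 14, 39, 54, 87, 92)` (case N); `(2, 14, 45, 66, 68, 93)` (case N); `(2, 14, 54, 60, 66, 92)` (case N); `(2, 14, 54, 66, 68, 84)` (case N); `(2, 26, 50, 56, 74, 80)` (case N); `(2, 27, 34, 72, 75, 78)` (case N); `(2, 28, 34, 54, 78, 92)` (case N); `(2, 32, 34, 54, 78, 88)` (case N); `(2, 32, 38, 50, 80, 86)` (case N); `(2, 33, 34, 45, 81, 93)` (case N); `(2, 33, 34, 54, 81, 84)` (case N); `(2, 34, 36, 45, 78, 93)` (case N); `(2, 34, 36, 50, 82, 84)` (case N); `(2, 34, 36, 54, 78, 84)` (case N); `(2, 34, 39, 54, 72, 87)` (case N); `(2, 34, 44, 54, 76, 78)` (case N); `(2, 34, 48, 54, 72, 78)` (case N); `(2, 34, 54, 56, 64, 78)` (case N); `(3, 10, 51, 70, 76, 78)` (case N); `(3, 10, 51, 72, 74, 78)` (case N); `(3, 15, 51, 62, 63, 94)` (case N); `(3, 18, 51, 60,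 62, 94)` (case N); `(3, 27, 51, 60, 72, 75)` (case N); `(3, 28, 30, 51, 82, 94)` (case N); `(3, 30, 50, 51, 62, 92)` (case N); `(3, 30, 50, 51, 72, 82)` (case N); `(3, 38, 39, 51, 70, 87)` (case N); `(3, 38, 44, 51, 74, 78)` (case N); `(3, 38, 51, 60, 66, 70)` (case N); `(4, 6, 18, 82, 84, 94)` (case N); `(4, 9, 42, 57, 82, 94)` (case N); `(4, 14, 46, 66, 68, 90)` (case N); `(4, 18, 21, 69, 82, 94)` (case N); `(4, 18, 22, 68, 86, 90)` (case N); `(4, 18, 42, 62, 68, 94)` (case N); `(4, 18, 42, 66, 68, 90)` (case N); `(4, 30, 36, 42, 82, 94)` (case N); `(4, 33, 34, 46, 81, 90)` (case N); `(4, 34, 36, 46, 78, 90)` (case N); `(4, 34, 45, 46, 66, 93)` (case N); `(4, 34, 46, 54, 66, 84)` (case N); `(4, 38, 42, 66, 68, 70)` (case N); `(6, 9, 50, 57, 82, 84)` (case N); `(6, 10, 28, 74, 78, 92)` (case N); `(6, 10, 32, 74, 78, 88)` (case N); `(6, 10, 33, 74, 81, 84)` (case N); `(6, 10, 36, 74,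 78, 84)` (case N); `(6, 10, 39, 70, 76, 87)` (case N); `(6, 10, 39, 72, 74, 87)` (case N); `(6, 10, 44, 74, 76, 78)` (case N); `(6, 10, 48, 72, 74, 78)` (case N); `(6, 10, 52, 66, 70, 84)` (case N); `(6, 10, 56, 64, 74, 78)` (case N); `(6, 10, 60, 66, 70, 76)` (case N); `(6, 15, 28, 63, 82, 94)` (case N); `(6, 15, 50, 62, 63, 92)` (case N); `(6, 15, 50, 63, 72, 82)` (case N); `(6, 18, 28, 60, 82, 94)` (case N); `(6, 18, 50, 60, 62, 92)` (case N); `(6, 18, 50, 62, 68, 84)` (case N); `(6, 20, 38, 66, 74, 84)` (case N); `(6, 28, 30, 50, 82, 92)` (case N); `(6, 28, 30, 54, 78, 92)` (case N); `(6, 30, 32, 50, 82, 88)` (case N); `(6, 30, 32, 54, 78, 88)` (case N); `(6, 30, 36, 50, 82, 84)` (case N); `(6, 30, 44, 50, 76, 82)` (case N); `(6, 30, 44, 54, 76, 78)` (case N); `(6, 30, 48, 50, 72, 82)` (case N); `(6, 30, 50, 56, 64, 82)` (case N); `(6, 30, 54, 56, 64, 78)` (case N); `(6, 38, 39, 44,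 74, 87)` (case N); `(6, 38, 44, 60, 66, 74)` (case N); `(8, 14, 38, 62, 80, 86)` (case N); `(8, 14, 46, 64, 66, 90)` (case N); `(8, 18, 22, 64, 86, 90)` (case N); `(8, 18, 42, 62, 64, 94)` (case N); `(8, 18, 42, 64, 66, 90)` (case N); `(8, 38, 42, 64, 66, 70)` (case N); `(9, 20, 26, 57, 86, 90)` (case N); `(9, 21, 50, 57, 69, 82)` (case N); `(9, 22, 24, 57, 86, 90)` (case N); `(9, 22, 52, 57, 58, 90)` (case N); `(9, 24, 33, 57, 81, 84)` (case N); `(9, 24, 42, 57, 62, 94)` (case N); `(9, 26, 45, 57, 58, 93)` (case N); `(9, 26, 54, 57, 58, 84)` (case N); `(9, 42, 50, 57, 62, 68)` (case N); `(10, 12, 42, 70, 76, 78)` (case N); `(10, 16, 34, 58, 82, 88)` (case N); `(10, 16, 46, 58, 64, 94)` (case N); `(10, 21, 33, 69, 74, 81)` (case N); `(10, 21, 36, 69, 74, 78)` (case N); `(10, 21, 52, 66, 69, 70)` (case N); `(10, 26, 36, 58, 74, 84)` (case N); `(10, 33, 42, 52, 70, 81)` (case N); `(10, 36, 42, 52,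 70, 78)` (case N); `(12, 14, 39, 46, 87, 90)` (case N); `(12, 14, 46, 60, 62, 94)` (case N); `(12, 14, 46, 60, 66, 90)` (case N); `(12, 15, 22, 63, 86, 90)` (case N); `(12, 15, 39, 63, 72, 87)` (case N); `(12, 15, 42, 62, 63, 94)` (case N); `(12, 18, 22, 60, 86, 90)` (case N); `(12, 18, 42, 60, 62, 94)` (case N); `(12, 22, 30, 58, 76, 90)` (case N); `(12, 22, 38, 60, 70, 86)` (case N); `(12, 26, 30, 44, 86, 90)` (case N); `(12, 28, 30, 42, 82, 94)` (case N); `(12, 28, 34, 46, 78, 90)` (case N); `(12, 30, 42, 50, 62, 92)` (case N); `(12, 38, 39, 42, 70, 87)` (case N); `(12, 38, 42, 44, 74, 78)` (case N); `(12, 38, 42, 60, 66, 70)` (case N); `(14, 20, 46, 52, 66, 90)` (case N); `(14, 24, 33, 46, 81, 90)` (case N); `(14, 24, 45, 46, 66, 93)` (case N); `(14, 24, 46, 48, 66, 90)` (case N); `(14, 26, 32, 62, 74, 80)` (case N); `(14, 27, 39, 46, 75, 87)` (case N); `(14, 27, 46, 60, 66, 75)` (case N); `(14, 32, 40, 46,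 66, 90)` (case N); `(15, 22, 27, 63, 75, 86)` (case N); `(15, 22, 54, 58, 63, 76)` (case N); `(15, 26, 44, 54, 63, 86)` (case N); `(15, 26, 54, 58, 63, 72)` (case N); `(16, 22, 34, 64, 70, 82)` (case N); `(16, 22, 40, 46, 70, 94)` (case N); `(18, 20, 22, 52, 86, 90)` (case N); `(18, 20, 26, 45, 86, 93)` (case N); `(18, 20, 26, 54, 84, 86)` (case N); `(18, 20, 42, 52, 62, 94)` (case N); `(18, 20, 42, 52, 66, 90)` (case N); `(18, 21, 24, 62, 69, 94)` (case N); `(18, 21, 50, 62, 68, 69)` (case N); `(18, 22, 24, 45, 86, 93)` (case N); `(18, 22, 24, 48, 86, 90)` (case N); `(18, 22, 27, 60, 75, 86)` (case N); `(18, 22, 32, 40, 86, 90)` (case N); `(18, 22, 45, 52, 58, 93)` (case N); `(18, 22, 52, 54, 58, 84)` (case N); `(18, 22, 54, 58, 60, 76)` (case N); `(18, 24, 42, 48, 62, 94)` (case N); `(18, 26, 44, 54, 60, 86)` (case N); `(18, 32, 40, 42, 62, 94)` (case N); `(18, 32, 40, 42, 66, 90)` (case N); `(20, 21, 38, 66,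 69, 74)` (case N); `(20, 26, 30, 36, 86, 90)` (case N); `(20, 33, 38, 42, 74, 81)` (case N); `(20, 36, 38, 42, 74, 78)` (case N); `(20, 38, 42, 52, 66, 70)` (case N); `(21, 24, 36, 45, 69, 93)` (case N); `(21, 24, 38, 66, 69, 70)` (case N); `(21, 30, 36, 50, 69, 82)` (case N); `(22, 27, 30, 58, 75, 76)` (case N); `(22, 30, 36, 52, 58, 90)` (case N); `(24, 33, 38, 42, 70, 81)` (case N); `(24, 38, 42, 48, 66, 70)` (case N); `(26, 27, 30, 44, 75, 86)` (case N); `(26, 27, 30, 58, 72, 75)` (case N); `(26, 28, 30, 54, 58, 92)` (case N); `(26, 30, 32, 54, 58, 88)` (case N); `(26, 30, 36, 45, 58, 93)` (case N); `(26, 30, 36, 54, 58, 84)` (case N); `(26, 30, 44, 54, 58, 76)` (case N); `(26, 30, 48, 54, 58, 72)` (case N); `(26, 30, 54, 56, 58, 64)` (case N); `(27, 28, 34, 46, 75, 78)` (case N); `(28, 34, 39, 46, 54, 87)` (case N); `(28, 34, 46, 54, 60, 66)` (case N); `(30, 36, 42, 50, 62, 68)` (case N); `(32, 38, 40, 42,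 66, 70)` (case N) — carry the table
certificate(s) written out in the statements below (generators checked by `genB`, the identity `s + ΣX = ΣY` by `decide`, all inside the kernel search).

PRINT STATUS (lit seat, 2026-08-20). `96 = 2⁵·3`: HC for every `Xⁿ₉₆` IS in print (Aoki 2000 Thm 0.1 (i), p. 185). The point of this level is Shioda's QUESTION (p. 184): `(Q⁴₉₆)` holds while `(P⁴₉₆)` fails; `96` has the largest certificate table of the twenty levels (192 sextuples without a `(P)`-witness; cell table, two implementations; kernel here).

References: [Shioda1979HodgeFermat] T. Shioda, Math. Ann. 245 (1979) 175–184, §3 p. 180 (`(Pⁿₘ)`), §4 pp. 183–184 (`M'ₘ`, `(Qⁿₘ)`, Claim,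
the question); [Shioda1979PJA] T. Shioda, Proc. Japan Acad. 55A (1979) §1 (Definition (i)–(iii), `(Pⁿₘ)'`); [daSilva2021HodgeFermat]
G. da Silva Jr., Experimental Results 2 (2021) e22, Def. 2.4, Question 1; [Aoki2000FermatTypeRemarks] N. Aoki, Comment. Math. Univ.
St. Pauli 49 (2000), Thm 0.1. Cell: `pub-hfermat-enum/P4-TABLE.md`, `data/shioda_Q4_m3-100.json`, `code/lit/q4/` (this seat).
-/

namespace Summit.HodgeConjecture.FermatCycles.ConditionQFourfold

open Multiset
open Literature.AlgebraicGeometry.HodgeTheory Literature.AlgebraicGeometry.HodgeTheory.FermatCharacter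
open Literature.AlgebraicGeometry.Shioda1982 Literature.AlgebraicGeometry.Shioda1979
open Summit.HodgeConjecture.FermatCycles.ShiodaConditionFourfold

/-! ### Level `96` — part J -/

/-! The certificate table at level `96` is the definition `table96` of `ConditionQFourfoldNinetySixTable.lean` (192 entries `(key, X, Y)`,
`s + ΣX = ΣY`; found by `code/lit/q4/q4norm.py`, every entry checked by the kernel inside the searches). -/

set_option maxHeartbeats 0 in
/-- The `(Q)`-search at level `96`, case N, first free representative in `[32, 96)` (40799 tuples). Kernel.
[cite: Shioda1979HodgeFermat, §4 condition (Qⁿₘ), p. 183] -/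
theorem checkQN_96_32 :
    checkQN 96
      table96
      32 64 = true := by
  decide +kernel

/-- **`(Q⁴ₘ)` holds at `m = 96`**: every Hodge sextuple over `ℤ/96` is `ξ₁ − ξ₂` with `ξ₁, ξ₂ ∈ M'ₘ` (stably generated by pairs, Hodge
`4`-sets and semi-decomposable sextuples). Kernel certificate of the cell's entry `96 ∈ Q4_true_P4_false` (P4-TABLE §(Q⁴ₘ)).
[cite: Shioda1979HodgeFermat, §4 condition (Qⁿₘ), p. 183] -/
theorem conditionQ_ninetySix_four : ConditionQ 96 4 :=
  haveI : Fact (1 < 96) := ⟨by norm_num⟩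
  conditionQ_four_of_normalized 96
    table96
    [(1, 13), (14, 11), (25, 14), (39, 57)]
    (by
      intro b h0 hN
      rcases Nat.lt_or_ge b 14 with h0 | h0
      · exact ⟨(1, 13), by simp, by omega, by omega⟩
      rcases Nat.lt_or_ge b 25 with h1 | h1
      · exact ⟨(14, 11), by simp, by omega, by omega⟩
      rcases Nat.lt_or_ge b 39 with h2 | h2
      · exact ⟨(25, 14), by simp, by omega, by omega⟩
      exact ⟨(39, 57), by simp, by omega, by omega⟩)
    (by
      intro p hp
      simp only [List.mem_cons, List.not_mem_nil, or_false] at hp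
      rcases hp with rfl | rfl | rfl | rfl
      · exact checkQU_96_1
      · exact checkQU_96_14
      · exact checkQU_96_25
      · exact checkQU_96_39)
    [(1, 2), (3, 1), (4, 2), (6, 2), (8, 1), (9, 1), (10, 2), (12, 2), (14, 1), (15, 1), (16, 2), (18, 2), (20, 2), (22, 4), (26, 6), (32, 64)]
    (by
      intro a h0 hN
      rcases Nat.lt_or_ge a 3 with h0 | h0
      · exact ⟨(1, 2), by simp, by omega, by omega⟩
      rcases Nat.lt_or_ge a 4 with h1 | h1
      · exact ⟨(3, 1), by simp, by omega, by omega⟩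
      rcases Nat.lt_or_ge a 6 with h2 | h2
      · exact ⟨(4, 2), by simp, by omega, by omega⟩
      rcases Nat.lt_or_ge a 8 with h3 | h3
      · exact ⟨(6, 2), by simp, by omega, by omega⟩
      rcases Nat.lt_or_ge a 9 with h4 | h4
      · exact ⟨(8, 1), by simp, by omega, by omega⟩
      rcases Nat.lt_or_ge a 10 with h5 | h5
      · exact ⟨(9, 1), by simp, by omega, by omega⟩
      rcases Nat.lt_or_ge a 12 with h6 | h6
      · exact ⟨(10, 2), by simp, by omega, by omega⟩
      rcases Nat.lt_or_ge a 14 with h7 | h7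
      · exact ⟨(12, 2), by simp, by omega, by omega⟩
      rcases Nat.lt_or_ge a 15 with h8 | h8
      · exact ⟨(14, 1), by simp, by omega, by omega⟩
      rcases Nat.lt_or_ge a 16 with h9 | h9
      · exact ⟨(15, 1), by simp, by omega, by omega⟩
      rcases Nat.lt_or_ge a 18 with h10 | h10
      · exact ⟨(16, 2), by simp, by omega, by omega⟩
      rcases Nat.lt_or_ge a 20 with h11 | h11
      · exact ⟨(18, 2), by simp, by omega, by omega⟩
      rcases Nat.lt_or_ge a 22 with h12 | h12
      · exact ⟨(20, 2), by simp, by omega, by omega⟩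
      rcases Nat.lt_or_ge a 26 with h13 | h13
      · exact ⟨(22, 4), by simp, by omega, by omega⟩
      rcases Nat.lt_or_ge a 32 with h14 | h14
      · exact ⟨(26, 6), by simp, by omega, by omega⟩
      exact ⟨(32, 64), by simp, by omega, by omega⟩)
    (by
      intro p hp
      simp only [List.mem_cons, List.not_mem_nil, or_false] at hp
      rcases hp with rfl | rfl | rfl | rfl | rfl | rfl | rfl | rfl | rfl | rfl | rfl | rfl | rfl | rfl | rfl | rfl
      · exact checkQN_96_1
      · exact checkQN_96_3
      · exact checkQN_96_4
      · exact checkQN_96_6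
      · exact checkQN_96_8
      · exact checkQN_96_9
      · exact checkQN_96_10
      · exact checkQN_96_12
      · exact checkQN_96_14
      · exact checkQN_96_15
      · exact checkQN_96_16
      · exact checkQN_96_18
      · exact checkQN_96_20
      · exact checkQN_96_22
      · exact checkQN_96_26
      · exact checkQN_96_32)

/-- **Shioda's Claim at `m = 96`**: every family of multisets over `ℤ/96` closed under the inductive structure of Fermat varieties
(pairs, surface classes, semi / star / hash) and under Lemma 3's cancellation contains every non-empty Hodge multiset with at most `6`
elements — the arithmetic form of "`(Q⁴ₘ)` ⇒ the Hodge conjecture for `X⁴ₘ`" at `m = 96` (geometric inputs = the hypotheses, as printed).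
[cite: Shioda1979HodgeFermat, §4 Claim, Lemmas 2–3, p. 183] -/
theorem forall_of_closed_cancellative_ninetySix {C : Multiset (ZMod 96) → Prop} (hC : IsShiodaClosed C) (hL : IsCancellative C) :
    ∀ s : Multiset (ZMod 96), s ≠ 0 → IsHodgeMultiset s → card s ≤ 6 → C s :=
  forall_of_conditionQ hC hL conditionQ_ninetySix_four

/-! ### The negative side at `m = 96`: `(P⁴ₘ)` fails on `s = (1, 6, 15, 79, 93, 94)` -/

/-- `s` is a Hodge sextuple over `ℤ/96` (a Hodge character of the Fermat fourfold of degree `96`). [cite: Shioda1979PJA, §1 eqs. (2)–(3)] -/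
theorem isHodgeMultiset_fail_ninetySix : IsHodgeMultiset ({1, 6, 15, 79, 93, 94} : Multiset (ZMod 96)) :=
  isHodgeMultiset_of_hodgeUB (N := 96) (by decide +kernel)

/-- Every proper non-empty sub-multiset of `s` has non-zero sum: `s` contains no pair `{a, −a}`, no Hodge sub-multiset, no zero-sum
triple. [cite: Shioda1979PJA, §1 Definition (i), (iii)] -/
theorem sum_ne_zero_of_mem_powerset_fail_ninetySix :
    ∀ t ∈ Multiset.powerset ({1, 6, 15, 79, 93, 94} : Multiset (ZMod 96)), t ≠ 0 → ({1, 6, 15, 79, 93, 94} : Multiset (ZMod 96)) - t ≠ 0 → t.sum ≠ 0 := by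
  decide +kernel

/-- `s` is **not decomposable** (a summand would be a proper non-empty zero-sum sub-multiset). [cite: Shioda1979PJA, §1 Definition (i)] -/
theorem not_isDecomposable_fail_ninetySix : ¬ IsDecomposable ({1, 6, 15, 79, 93, 94} : Multiset (ZMod 96)) := by
  rintro ⟨t, u, ht0, hu0, ht, -, heq⟩
  have htle : t ≤ ({1, 6, 15, 79, 93, 94} : Multiset (ZMod 96)) := heq ▸ Multiset.le_add_right t u
  have hu : ({1, 6, 15, 79, 93, 94} : Multiset (ZMod 96)) - t = u := by rw [heq, add_tsub_cancel_left]
  exact sum_ne_zero_of_mem_powerset_fail_ninetySix t (Multiset.mem_powerset.2 htle) ht0 (hu ▸ hu0) ht.1.2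

/-- `s` is **not semi-decomposable** (no zero-sum triple). [cite: Shioda1979PJA, §1 Definition (iii)] -/
theorem not_isSemiDecomposable_fail_ninetySix : ¬ IsSemiDecomposable ({1, 6, 15, 79, 93, 94} : Multiset (ZMod 96)) := by
  rintro ⟨t, u, ht3, hu3, hts, -, heq⟩
  have htle : t ≤ ({1, 6, 15, 79, 93, 94} : Multiset (ZMod 96)) := heq ▸ Multiset.le_add_right t u
  have hu : ({1, 6, 15, 79, 93, 94} : Multiset (ZMod 96)) - t = u := by rw [heq, add_tsub_cancel_left]
  have ht0 : t ≠ 0 := by rintro rfl; simp at ht3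
  have hu0 : u ≠ 0 := by rintro rfl; simp at hu3
  exact sum_ne_zero_of_mem_powerset_fail_ninetySix t (Multiset.mem_powerset.2 htle) ht0 (hu ▸ hu0) hts

/-- A Hodge multiset over `ℤ/96` satisfies the finitely many conditions used by the kernel refutation below (entries non-zero, sum
zero, Shioda's norm equation at the units `1, 11, 13, 17, 25` — a sub-family of Shioda's equations (2) that already admits no splitting, chosen by
`code/lit/q4/minunits.py`). [cite: Shioda1979PJA, §1 eq. (2)] -/
theorem hodgeConditions_ninetySix {v : Multiset (ZMod 96)} (hv : IsHodgeMultiset v) :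
    ((v).sum = 0 ∧ (∀ a ∈ v, a ≠ 0) ∧
            2 * mNormSum ((v).map fun a ↦ (1 : ZMod 96) * a) = 96 * Multiset.card (v) ∧
            2 * mNormSum ((v).map fun a ↦ (11 : ZMod 96) * a) = 96 * Multiset.card (v) ∧
            2 * mNormSum ((v).map fun a ↦ (13 : ZMod 96) * a) = 96 * Multiset.card (v) ∧
            2 * mNormSum ((v).map fun a ↦ (17 : ZMod 96) * a) = 96 * Multiset.card (v) ∧
            2 * mNormSum ((v).map fun a ↦ (25 : ZMod 96) * a) = 96 * Multiset.card (v)) := by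
  have h1 := hv.2 (Units.mkOfMulEqOne 1 1 (by decide))
  have h11 := hv.2 (Units.mkOfMulEqOne 11 35 (by decide))
  have h13 := hv.2 (Units.mkOfMulEqOne 13 37 (by decide))
  have h17 := hv.2 (Units.mkOfMulEqOne 17 17 (by decide))
  have h25 := hv.2 (Units.mkOfMulEqOne 25 73 (by decide))
  simp only [Units.val_mkOfMulEqOne] at h1 h11 h13 h17 h25
  exact ⟨hv.1.2, hv.1.1, h1, h11, h13, h17, h25⟩

set_option maxHeartbeats 0 in
/-- The arithmetic heart of "`s` is **not quasi-decomposable**": for every `e ∈ ℤ/96` and every splitting `s + {e, −e} = t + u` into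
non-empty parts different from `s`, one of `t`, `u` violates a condition of `hodgeConditions_ninetySix` (the zero-sum test comes first, so
the kernel discards almost every splitting on one addition). Kernel, one residue `e` at a time (`96 · 2⁸` cases). [cite: daSilva2021HodgeFermat, Def. 2.4] [cite: Shioda1979PJA, §1 Definition (ii)] -/
theorem fail_ninetySix_key :
    ∀ e : ZMod 96, ∀ t ∈ Multiset.powerset (({1, 6, 15, 79, 93, 94} : Multiset (ZMod 96)) + {e, -e}),
      ¬ (((t).sum = 0 ∧ (∀ a ∈ t, a ≠ 0) ∧
            2 * mNormSum ((t).map fun a ↦ (1 : ZMod 96) * a) = 96 * Multiset.card (t) ∧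
            2 * mNormSum ((t).map fun a ↦ (11 : ZMod 96) * a) = 96 * Multiset.card (t) ∧
            2 * mNormSum ((t).map fun a ↦ (13 : ZMod 96) * a) = 96 * Multiset.card (t) ∧
            2 * mNormSum ((t).map fun a ↦ (17 : ZMod 96) * a) = 96 * Multiset.card (t) ∧
            2 * mNormSum ((t).map fun a ↦ (25 : ZMod 96) * a) = 96 * Multiset.card (t)) ∧
          (((({1, 6, 15, 79, 93, 94} : Multiset (ZMod 96)) + {e, -e}) - t).sum = 0 ∧ (∀ a ∈ (({1, 6, 15, 79, 93, 94} : Multiset (ZMod 96)) + {e, -e}) - t, a ≠ 0) ∧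
            2 * mNormSum (((({1, 6, 15, 79, 93, 94} : Multiset (ZMod 96)) + {e, -e}) - t).map fun a ↦ (1 : ZMod 96) * a) = 96 * Multiset.card ((({1, 6, 15, 79, 93, 94} : Multiset (ZMod 96)) + {e, -e}) - t) ∧
            2 * mNormSum (((({1, 6, 15, 79, 93, 94} : Multiset (ZMod 96)) + {e, -e}) - t).map fun a ↦ (11 : ZMod 96) * a) = 96 * Multiset.card ((({1, 6, 15, 79, 93, 94} : Multiset (ZMod 96)) + {e, -e}) - t) ∧
            2 * mNormSum (((({1, 6, 15, 79, 93, 94} : Multiset (ZMod 96)) + {e, -e}) - t).map fun a ↦ (13 : ZMod 96) * a) = 96 * Multiset.card ((({1, 6, 15, 79, 93, 94} : Multiset (ZMod 96)) + {e, -e}) - t) ∧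
            2 * mNormSum (((({1, 6, 15, 79, 93, 94} : Multiset (ZMod 96)) + {e, -e}) - t).map fun a ↦ (17 : ZMod 96) * a) = 96 * Multiset.card ((({1, 6, 15, 79, 93, 94} : Multiset (ZMod 96)) + {e, -e}) - t) ∧
            2 * mNormSum (((({1, 6, 15, 79, 93, 94} : Multiset (ZMod 96)) + {e, -e}) - t).map fun a ↦ (25 : ZMod 96) * a) = 96 * Multiset.card ((({1, 6, 15, 79, 93, 94} : Multiset (ZMod 96)) + {e, -e}) - t)) ∧
          t ≠ 0 ∧ (({1, 6, 15, 79, 93, 94} : Multiset (ZMod 96)) + {e, -e}) - t ≠ 0 ∧ t ≠ ({1, 6, 15, 79, 93, 94} : Multiset (ZMod 96)) ∧ (({1, 6, 15, 79, 93, 94} : Multiset (ZMod 96)) + {e, -e}) - t ≠ ({1, 6, 15, 79, 93, 94} : Multiset (ZMod 96))) := by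
  intro e
  obtain ⟨k, hk, rfl⟩ : ∃ k < 96, ((k : ℕ) : ZMod 96) = e :=
    ⟨e.val, e.val_lt, ZMod.natCast_zmod_val e⟩
  interval_cases k <;> decide +kernel

/-- `s` is **not quasi-decomposable** (no `e ≠ 0` with `s + {e, −e} = ξ' + ξ''`, `ξ', ξ''` Hodge, both different from `s`).
[cite: daSilva2021HodgeFermat, Def. 2.4] [cite: Shioda1979PJA, §1 Definition (ii)] -/
theorem not_isQuasiDecomposable_fail_ninetySix : ¬ IsQuasiDecomposable ({1, 6, 15, 79, 93, 94} : Multiset (ZMod 96)) := by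
  rintro ⟨e, -, t, u, ht0, hu0, ht, hu, hts, hus, heq⟩
  have htle : t ≤ ({1, 6, 15, 79, 93, 94} : Multiset (ZMod 96)) + {e, -e} := heq ▸ Multiset.le_add_right t u
  have hu' : ({1, 6, 15, 79, 93, 94} : Multiset (ZMod 96)) + {e, -e} - t = u := by rw [heq, add_tsub_cancel_left]
  subst hu'
  exact fail_ninetySix_key e t (Multiset.mem_powerset.2 htle)
    ⟨hodgeConditions_ninetySix ht, hodgeConditions_ninetySix hu, ht0, hu0, hts, hus⟩

/-- **`(P⁴ₘ)` fails at `m = 96`** (Proc. Japan Acad. form, tree `ShiodaConditionUpTo 96 4`): the Hodge sextuple `s` is neither decomposable,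
nor quasi-decomposable, nor semi-decomposable. Kernel certificate of the cell's P4-TABLE entry (two implementations + referee).
[cite: Shioda1979PJA, §1 condition (Pⁿₘ)] -/
theorem not_shiodaConditionUpTo_ninetySix_four : ¬ ShiodaConditionUpTo 96 4 := fun h ↦ by
  rcases h _ isHodgeMultiset_fail_ninetySix (by decide) (by decide) with hd | hq | hs
  · exact not_isDecomposable_fail_ninetySix hd
  · exact not_isQuasiDecomposable_fail_ninetySix hq
  · exact not_isSemiDecomposable_fail_ninetySix hs

/-- Hence `(Pₘ)` (Proc. Japan Acad. form, all lengths) fails at `m = 96`. [cite: Shioda1979PJA, §1 conditions (Pⁿₘ), (Pₘ)] -/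
theorem not_shiodaCondition_ninetySix : ¬ ShiodaCondition 96 := fun h ↦
  not_shiodaConditionUpTo_ninetySix_four (shiodaCondition_iff_forall_upTo.1 h 4)

/-- **The Math. Ann. form of `(P⁴ₘ)` fails at `m = 96`** too: `s` is indecomposable and not quasi-decomposable.
[cite: Shioda1979HodgeFermat, §3 condition (Pⁿₘ), p. 180] -/
theorem not_conditionP_ninetySix_four : ¬ ConditionP 96 4 := fun h ↦
  not_isQuasiDecomposable_fail_ninetySix
    (h _ isHodgeMultiset_fail_ninetySix (by decide) (by decide) not_isDecomposable_fail_ninetySix)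

/-- Hence the Math. Ann. condition `(Pₘ)` fails at `m = 96`. [cite: Shioda1979HodgeFermat, §3 condition (Pₘ), p. 180] -/
theorem not_conditionPAll_ninetySix : ¬ ConditionPAll 96 := fun h ↦
  not_conditionP_ninetySix_four (conditionPAll_iff_forall.1 h 4)

/-- **Shioda's question (Math. Ann. 245, p. 184), the fourfold instance at `m = 96`**: "we do not know any value of `m` which satisfies
`(Qₘ)` but not `(Pₘ)`" — at `m = 96` the length-`3` condition `(Q⁴ₘ)` HOLDS while `(P⁴ₘ)` FAILS (in both printed forms). Whether `(Qₘ)` holds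
at ALL lengths for `m = 96` is not decided here. Computer-assisted (cell `pub-hfermat`, two implementations), certified by the kernel.
[cite: Shioda1979HodgeFermat, §4, p. 184 (the question)] -/
theorem conditionQ_not_conditionP_ninetySix : ConditionQ 96 4 ∧ ¬ ConditionP 96 4 :=
  ⟨conditionQ_ninetySix_four, not_conditionP_ninetySix_four⟩

end Summit.HodgeConjecture.FermatCycles.ConditionQFourfold
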